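import Summits.AnomalousDissipation.AnomalousDissipation.Theorems.BaireTransferRobustLoudUpgradeLine
import Literature.Analysis.FluidPDE.LerayProjectorTorusProofs
import Literature.Analysis.FunctionSpaces.TorusFourierModes
import Literature.Analysis.FunctionSpaces.TorusSpaceTime
import Literature.Analysis.FunctionSpaces.TorusFourierCalculus

/-!
# Negative knowledge for the crux `RobustLoudUpgrade` (stmt-AnomalousDissipation-1144), part 1/2:
# the Galilean-DRIFT field of the Kolmogorov force — vocabulary and calculus

Refuter (drefute of line `malkin-cone-group-orbits`, skeleton v2).  The v2 TAME classes of the line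
(`nondegSteady`, `persistSteady`, `censusSteady`, `malkinSteady` of
`Theorems/BaireTransferRobustLoudUpgradeLine.lean`) admit only MEAN-ZERO steady witnesses, and
`nondegPeriodic` excludes steady states.  This file and its sequel `GalileanDrift.lean` certify that the loud
set of the line nevertheless contains, for the gravest shear (Kolmogorov) force
`f = A sin(2πx₂) e₁ = force S (cLam S A)` and EVERY drift `m : ℝ`, an exact classical steady state with mean
`(0, m, 0)`: `u_{w,m} = Re (e_{k₀} • w v₀) + m e₂` (`driftField w m`) with `w = A/(4π²ν + 2πi m)` — the laminar
profile advected ACROSS the shear by its own mean (amplitude-reduced, phase-lagged).  Here: the shear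
vocabulary `k₀, v₀, cLam` (certified copy of `Cruxes/RobustLoudUpgrade/Disproof.lean` §6, cdisprove gen. 3,
re-vendored so that no Theorems file imports a crux work file), the force identity `force_cLam`, the drift
field as a real trigonometric polynomial on `{0, ±k₀}` (smooth, divergence free), its decomposition
`driftField_apply`, and its calculus: `∂₀u = 0`, `∂₁u = Φ_{2πi w}`, `Δu = Φ_{−4π²w}`,
`(u·∇)u = m Φ_{2πi w}` (`convect_driftField`: only the mean advects the profile).  Supports
stmt-AnomalousDissipation-1144.
-/

set_option linter.dupNamespace false

noncomputable section

namespace Summit.AnomalousDissipation.AnomalousDissipation.Theorems.RobustLoudUpgrade.Negative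

open scoped BigOperators Topology ENNReal InnerProductSpace ComplexConjugate
open Filter Set MeasureTheory
open Literature.Analysis.FunctionSpaces Literature.Analysis.FunctionSpaces.Torus
open Literature.Analysis.FluidPDE
open Summit.AnomalousDissipation.AnomalousDissipation.Theses.BaireTransfer
open UnitAddTorus EuclideanSpace

/-- The flat unit torus `T³`. -/
local notation "𝕋³" => UnitAddTorus (Fin 3)
/-- Real velocity values. -/
local notation "ℝ³" => EuclideanSpace ℝ (Fin 3)
/-- Complex Fourier coefficients. -/
local notation "ℂ³" => EuclideanSpace ℂ (Fin 3)

namespace GalileanDrift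

/-! ## §1 Shear vocabulary (certified copy of Disproof §6) -/

/-- The gravest shear frequency `k₀ = (0,1,0)`. [folklore] -/
def k₀ : Fin 3 → ℤ := Pi.single 1 1

/-- The polarisation `v₀ = (−i, 0, 0) ⊥ k₀` (so that `Re (e_{k₀} • v₀) = sin(2πx₂) e₁`). [folklore] -/
def v₀ : ℂ³ := WithLp.toLp 2 (Pi.single 0 (-Complex.I))

/-- Coordinates of `k₀`. [folklore] -/
theorem k₀_apply (i : Fin 3) : k₀ i = if i = 1 then 1 else 0 := by
  simp [k₀, Pi.single_apply]

/-- Coordinates of `v₀`. [folklore] -/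
theorem v₀_apply (i : Fin 3) : v₀ i = if i = 0 then -Complex.I else 0 := by
  simp [v₀]

/-- `k₀ ≠ 0`. [folklore] -/
theorem k₀_ne_zero : k₀ ≠ 0 := by
  intro h; have := congrFun h 1; simp [k₀] at this

/-- `−k₀ ≠ k₀`. [folklore] -/
theorem neg_k₀_ne : -k₀ ≠ k₀ := by
  intro h; have := congrFun h 1; simp [k₀] at this

/-- `−k₀ ≠ 0`. [folklore] -/
theorem neg_k₀_ne_zero : -k₀ ≠ 0 := neg_ne_zero.2 k₀_ne_zero

/-- `|k₀|² = 1`. [folklore] -/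
theorem freqNormSq_k₀ : freqNormSq k₀ = 1 := by
  simp [freqNormSq, k₀_apply]

/-- `‖v₀‖ = 1`. [folklore] -/
theorem norm_v₀ : ‖v₀‖ = 1 := by
  rw [EuclideanSpace.norm_eq]
  simp [v₀_apply, Fin.sum_univ_three]

variable {S : Finset (Fin 3 → ℤ)}

/-- The laminar coefficient vector of amplitude `A` in any `P_S` with `k₀ ∈ S` (`f_{cLam A} = A sin(2πx₂) e₁`). [folklore] -/
def cLam (S : Finset (Fin 3 → ℤ)) (A : ℝ) : Coeff S :=
  fun k => if (k : Fin 3 → ℤ) = k₀ then (A : ℂ) • v₀ else 0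

/-- The Leray multiplier fixes the transversal polarisation `A v₀` at `k₀`. -/
theorem lerayCoeff_k₀ (A : ℝ) : Torus.lerayCoeff k₀ ((A : ℂ) • v₀) = (A : ℂ) • v₀ := by
  rw [Torus.lerayCoeff, if_neg k₀_ne_zero]
  have : ∑ i, (k₀ i : ℂ) * (((A : ℂ) • v₀) i) = 0 := by
    simp [k₀_apply, v₀_apply]
  rw [this, zero_div, zero_smul, sub_zero]

/-- The Leray multiplier kills the zero vector at every frequency. [folklore] -/
theorem lerayCoeff_zero_vec (k : Fin 3 → ℤ) : Torus.lerayCoeff k (0 : ℂ³) = 0 := by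
  by_cases hk : k = 0
  · subst hk; simp
  · rw [Torus.lerayCoeff, if_neg hk]; simp

/-- The force coefficients of `cLam A`: `A v₀` at `k₀`, zero elsewhere. -/
theorem forceCoeff_cLam (hS : k₀ ∈ S) (A : ℝ) (k : Fin 3 → ℤ) :
    Torus.lerayCoeff k (coeffExt S (cLam S A) k) = if k = k₀ then (A : ℂ) • v₀ else 0 := by
  by_cases hk : k = k₀
  · subst hk
    rw [if_pos rfl, coeffExt_of_mem _ hS]
    have : cLam S A ⟨k₀, hS⟩ = (A : ℂ) • v₀ := by simp [cLam]
    rw [this, lerayCoeff_k₀]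
  · rw [if_neg hk]
    have hz : coeffExt S (cLam S A) k = 0 := by
      by_cases hkS : k ∈ S
      · rw [coeffExt_of_mem _ hkS]; simp [cLam, hk]
      · exact coeffExt_of_not_mem _ hkS
    rw [hz, lerayCoeff_zero_vec]

/-- The elementary shear-polarised field `Φ_w(x) = Re (e_{k₀}(x) • w v₀)` (`w ∈ ℂ`): for `w = A` real it is
`A sin(2πx₂) e₁`, for general `w = α + iβ` it is `(α sin + β cos)(2πx₂) e₁`. [folklore] -/
def Φ (w : ℂ) (x : 𝕋³) : ℝ³ := realPart (mFourier k₀ x • (w • v₀))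

/-- `Φ` is additive in the complex amplitude. [folklore] -/
theorem Φ_add (w w' : ℂ) (x : 𝕋³) : Φ (w + w') x = Φ w x + Φ w' x := by
  simp only [Φ, add_smul, smul_add, map_add]

/-- `Φ` is real-homogeneous in the complex amplitude. [folklore] -/
theorem Φ_real_smul (r : ℝ) (w : ℂ) (x : 𝕋³) : Φ ((r : ℂ) * w) x = r • Φ w x := by
  simp only [Φ]
  rw [mul_smul, smul_comm (mFourier k₀ x) (r : ℂ) (w • v₀), Complex.coe_smul, map_smul]

/-- **`f_{cLam A} = Φ_A`**: the designer force of the laminar coefficient vector is the shear force. -/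
theorem force_cLam (hS : k₀ ∈ S) (A : ℝ) (x : 𝕋³) : force S (cLam S A) x = Φ (A : ℂ) x := by
  rw [force, realTrigPoly_apply, trigPoly_apply,
    Finset.sum_eq_single_of_mem k₀ hS fun k _ hk => by rw [forceCoeff_cLam hS, if_neg hk, smul_zero],
    forceCoeff_cLam hS, if_pos rfl]
  rfl

/-! ## §2 The drift field as a real trigonometric polynomial on `T₁ = {0, k₀, −k₀}` -/

/-- The symmetric support `{0, k₀, −k₀}`. [folklore] -/
def T₁ : Finset (Fin 3 → ℤ) := insert 0 {k₀, -k₀}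

/-- `T₁` is symmetric under `k ↦ −k`. [folklore] -/
theorem T₁_symm : ∀ k ∈ T₁, -k ∈ T₁ := by
  intro k hk
  simp only [T₁, Finset.mem_insert, Finset.mem_singleton] at hk ⊢
  rcases hk with rfl | rfl | rfl
  · exact Or.inl neg_zero
  · exact Or.inr (Or.inr rfl)
  · exact Or.inr (Or.inl (neg_neg _))

/-- The constant mode `m e₂` (complex coefficients). [folklore] -/
def mC (m : ℝ) : ℂ³ := EuclideanSpace.single 1 (m : ℂ)

/-- Coefficient family of the drift field: `m e₂` at `0`, `(w/2) v₀` at `k₀`, its conjugate at `−k₀`. [folklore] -/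
def W (w : ℂ) (m : ℝ) : (Fin 3 → ℤ) → ℂ³ := fun k =>
  if k = 0 then mC m else if k = k₀ then (w / 2) • v₀ else if k = -k₀ then (conj w / 2) • conjVec v₀ else 0

/-- The zero mode of `W` is the constant `m e₂`. [folklore] -/
theorem W_zero (w : ℂ) (m : ℝ) : W w m 0 = mC m := by simp [W]

/-- The `k₀` mode of `W`. [folklore] -/
theorem W_k₀ (w : ℂ) (m : ℝ) : W w m k₀ = (w / 2) • v₀ := by simp [W, k₀_ne_zero]

/-- The `−k₀` mode of `W` (conjugate of the `k₀` mode). [folklore] -/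
theorem W_neg_k₀ (w : ℂ) (m : ℝ) : W w m (-k₀) = (conj w / 2) • conjVec v₀ := by
  simp [W, k₀_ne_zero, neg_k₀_ne]

/-- `W` vanishes off `T₁`. [folklore] -/
theorem W_of_ne {w : ℂ} {m : ℝ} {k : Fin 3 → ℤ} (h0 : k ≠ 0) (h1 : k ≠ k₀) (h2 : k ≠ -k₀) :
    W w m k = 0 := by simp [W, h0, h1, h2]

/-- The constant mode is real (conjugation invariant). [folklore] -/
theorem conjVec_mC (m : ℝ) : conjVec (mC m) = mC m := by
  ext i; simp [mC, conjVec_apply]; split_ifs <;> simp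

/-- `W` is conjugate symmetric (reality of the drift field). [folklore] -/
theorem isConjSymm_W (w : ℂ) (m : ℝ) : IsConjSymm (W w m) := by
  intro k
  by_cases h0 : k = 0
  · subst h0; rw [neg_zero, W_zero, conjVec_mC]
  by_cases h1 : k = k₀
  · subst h1
    rw [W_neg_k₀, W_k₀, conjVec_smul, map_div₀, Complex.conj_ofNat]
  by_cases h2 : k = -k₀
  · subst h2
    rw [neg_neg, W_k₀, W_neg_k₀, conjVec_smul, conjVec_conjVec, map_div₀, Complex.conj_conj,
      Complex.conj_ofNat]
  · have h0' : -k ≠ 0 := neg_ne_zero.2 h0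
    have h1' : -k ≠ k₀ := fun h => h2 (by rw [← h, neg_neg])
    have h2' : -k ≠ -k₀ := fun h => h1 (neg_injective h)
    rw [W_of_ne h0' h1' h2', W_of_ne h0 h1 h2, conjVec_zero]

/-- `W` is transversal (`k · W k = 0`): the drift field is divergence free. [folklore] -/
theorem isTransversal_W (w : ℂ) (m : ℝ) : IsTransversal T₁ (W w m) := by
  intro k hk
  simp only [T₁, Finset.mem_insert, Finset.mem_singleton] at hk
  rcases hk with rfl | rfl | rfl
  · simp
  · simp [W_k₀, k₀_apply, v₀_apply]
  · simp [W_neg_k₀, k₀_apply, v₀_apply, conjVec_apply]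

/-- **The drift field** `u_{w,m} = Re (e_{k₀} • w v₀) + m e₂` as a real trigonometric polynomial. [folklore] -/
def driftField (w : ℂ) (m : ℝ) : 𝕋³ → ℝ³ := realTrigPoly T₁ (W w m)

/-- The drift field is smooth. [folklore] -/
theorem isSmooth_driftField (w : ℂ) (m : ℝ) : IsSmooth (driftField w m) := isSmooth_realTrigPoly _ _

/-- The drift field is divergence free. [folklore] -/
theorem isDivFree_driftField (w : ℂ) (m : ℝ) : IsDivFree (driftField w m) :=
  isDivFree_realTrigPoly (isTransversal_W w m)

/-- The real constant vector `m e₂`. [folklore] -/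
def mR (m : ℝ) : ℝ³ := EuclideanSpace.single 1 m

/-- The real part of the constant mode is `m e₂`. [folklore] -/
theorem realPart_mC (m : ℝ) : realPart (mC m) = mR m := by
  ext i; simp [mC, mR]; split_ifs <;> simp

/-- `0 ∉ {k₀, −k₀}`. [folklore] -/
theorem zero_not_mem_T₀ : (0 : Fin 3 → ℤ) ∉ ({k₀, -k₀} : Finset (Fin 3 → ℤ)) := by
  simp [k₀_ne_zero.symm, neg_k₀_ne_zero.symm]

/-- `k₀ ∉ {−k₀}`. [folklore] -/
theorem k₀_not_mem : k₀ ∉ ({-k₀} : Finset (Fin 3 → ℤ)) := by simp [neg_k₀_ne.symm]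

/-- **Pointwise decomposition**: `driftField w m x = Φ_w(x) + m e₂`. -/
theorem driftField_apply (w : ℂ) (m : ℝ) (x : 𝕋³) : driftField w m x = Φ w x + mR m := by
  rw [driftField, realTrigPoly_apply, trigPoly_apply, T₁, Finset.sum_insert zero_not_mem_T₀,
    Finset.sum_insert k₀_not_mem, Finset.sum_singleton, W_zero, W_k₀, W_neg_k₀, map_add, map_add]
  have h0 : realPart (mFourier (0 : Fin 3 → ℤ) x • mC m) = mR m := by
    rw [show mFourier (0 : Fin 3 → ℤ) x = 1 from by simp [UnitAddTorus.mFourier_zero], one_smul,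
      realPart_mC]
  have hconj : mFourier (-k₀) x • ((conj w / 2) • conjVec v₀) = conjVec (mFourier k₀ x • ((w / 2) • v₀)) := by
    rw [conjVec_smul, conjVec_smul, mFourier_neg, map_div₀, Complex.conj_ofNat]
  rw [h0, hconj, realPart_conjVec, add_comm (mR m)]
  congr 1
  rw [← two_smul ℝ (realPart (mFourier k₀ x • ((w / 2) • v₀))), ← map_smul, Φ]
  congr 1
  rw [smul_comm (2 : ℝ) (mFourier k₀ x)]
  congr 1
  rw [← Complex.coe_smul, smul_smul]
  congr 1
  push_cast; ring


/-! ## §3 Calculus of the drift field -/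

/-- `mC 0 = 0`. [folklore] -/
theorem mC_zero : mC 0 = 0 := by
  simp [mC]

/-- `mR 0 = 0`. [folklore] -/
theorem mR_zero : mR 0 = 0 := by
  simp [mR]

/-- The drift field does not depend on `x₁`: `∂₀ u = 0`. -/
theorem partialDeriv_zero_driftField (w : ℂ) (m : ℝ) (x : 𝕋³) : partialDeriv 0 (driftField w m) x = 0 := by
  rw [driftField, partialDeriv_realTrigPoly]
  have h : realTrigPoly T₁ (fun k => (2 * Real.pi * Complex.I * (k (0 : Fin 3) : ℂ)) • W w m k) =
      realTrigPoly T₁ 0 := by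
    refine realTrigPoly_congr fun k hk => ?_
    simp only [T₁, Finset.mem_insert, Finset.mem_singleton] at hk
    rcases hk with rfl | rfl | rfl <;> simp [k₀_apply]
  rw [h, realTrigPoly_zero]
  rfl

/-- `∂₁ u_{w,m} = Φ_{2πi w}` (the cross-stream derivative of the shear profile). -/
theorem partialDeriv_one_driftField (w : ℂ) (m : ℝ) (x : 𝕋³) :
    partialDeriv 1 (driftField w m) x = Φ (2 * Real.pi * Complex.I * w) x := by
  rw [driftField, partialDeriv_realTrigPoly]
  have h : realTrigPoly T₁ (fun k => (2 * Real.pi * Complex.I * (k (1 : Fin 3) : ℂ)) • W w m k) =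
      realTrigPoly T₁ (W (2 * Real.pi * Complex.I * w) 0) := by
    refine realTrigPoly_congr fun k hk => ?_
    simp only [T₁, Finset.mem_insert, Finset.mem_singleton] at hk
    rcases hk with rfl | rfl | rfl
    · simp [W_zero, mC_zero]
    · rw [W_k₀, W_k₀, smul_smul, k₀_apply]; congr 1; push_cast; ring
    · rw [W_neg_k₀, W_neg_k₀, smul_smul, Pi.neg_apply, k₀_apply]; congr 1
      simp only [if_true, map_mul, Complex.conj_ofReal, Complex.conj_I, Complex.conj_ofNat]
      push_cast; ring
  rw [h]
  change driftField (2 * Real.pi * Complex.I * w) 0 x = _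
  rw [driftField_apply, mR_zero, add_zero]

/-- `Δ u_{w,m} = Φ_{−4π² w}` (the constant mode is harmonic, the shear modes are Stokes eigenfields). -/
theorem laplacian_driftField (w : ℂ) (m : ℝ) (x : 𝕋³) :
    laplacian (driftField w m) x = Φ (-(4 * Real.pi ^ 2) * w) x := by
  rw [driftField, laplacian_realTrigPoly]
  have h : realTrigPoly T₁ (fun k => -(((4 * Real.pi ^ 2 * freqNormSq k : ℝ) : ℂ) • W w m k)) =
      realTrigPoly T₁ (W (-(4 * Real.pi ^ 2) * w) 0) := by
    refine realTrigPoly_congr fun k hk => ?_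
    simp only [T₁, Finset.mem_insert, Finset.mem_singleton] at hk
    rcases hk with rfl | rfl | rfl
    · simp [W_zero, mC_zero, freqNormSq_zero]
    · rw [W_k₀, W_k₀, freqNormSq_k₀, smul_smul, ← neg_smul]; congr 1; push_cast; ring
    · rw [W_neg_k₀, W_neg_k₀, freqNormSq_neg, freqNormSq_k₀, smul_smul, ← neg_smul]; congr 1
      simp only [map_mul, map_neg, Complex.conj_ofReal, map_pow, Complex.conj_ofNat]
      push_cast; ring
  rw [h]
  change driftField (-(4 * Real.pi ^ 2) * w) 0 x = _
  rw [driftField_apply, mR_zero, add_zero]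

/-- The shear-polarised field is parallel to `e₁`. -/
theorem Φ_apply_of_ne (w : ℂ) (x : 𝕋³) {i : Fin 3} (hi : i ≠ 0) : Φ w x i = 0 := by
  simp [Φ, v₀_apply, hi]

/-- Value decomposition `u(x) = u(x)₀ e₁ + m e₂` (no `e₃` component). -/
theorem driftField_eq_basis (w : ℂ) (m : ℝ) (x : 𝕋³) :
    driftField w m x = (driftField w m x 0) • EuclideanSpace.single (0 : Fin 3) (1 : ℝ) +
      m • EuclideanSpace.single (1 : Fin 3) (1 : ℝ) := by
  ext i
  rw [driftField_apply]
  fin_cases i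
  · simp [mR]
  · simp [mR, Φ_apply_of_ne]
  · simp [mR, Φ_apply_of_ne]

/-- **Self-advection of the drift field**: `(u·∇)u = m ∂₁u = m Φ_{2πi w}` — only the mean advects
the profile, across the shear. -/
theorem convect_driftField (w : ℂ) (m : ℝ) (x : 𝕋³) :
    Torus.convect (driftField w m) (driftField w m) x = m • Φ (2 * Real.pi * Complex.I * w) x := by
  have hC : IsContDiff 1 (driftField w m) := (isSmooth_driftField w m).isContDiff (by simp)
  unfold Torus.convect
  rw [driftField_eq_basis w m x, map_add, map_smul, map_smul, ← partialDeriv_eq_fderiv_apply hC,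
    ← partialDeriv_eq_fderiv_apply hC, partialDeriv_zero_driftField, smul_zero, zero_add,
    partialDeriv_one_driftField]

end GalileanDrift

end Summit.AnomalousDissipation.AnomalousDissipation.Theorems.RobustLoudUpgrade.Negative

end
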